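/-
Copyright (c) 2026. All rights reserved.
Released under Apache 2.0 license as described in the file LICENSE.
Authors: abc-iut cell — seat abc-iut-f-104 (F fact-proving wave, tranche 104: FACT-LIST rows F-0181
`MonoAnalyticizationExists`, F-0182 `PanalocalizationExists` of `PanalocalTheaters.lean`), gen 3.
-/
import Literature.AnabelianGeometry.AbsoluteAnabelian.PanalocalTheatersStructuralHom
import Literature.AnabelianGeometry.AbsoluteAnabelian.NFGaloisGroupsProofs
import Literature.AnabelianGeometry.AbsoluteAnabelian.NFDecompositionRelSlimProofs
import Literature.AnabelianGeometry.AbsoluteAnabelian.NFDecompositionNonCommensurableProofs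
import Literature.NumberTheory.GaloisRepresentations.DecompositionGroupOfCompletion
import Literature.NumberTheory.GaloisRepresentations.IntegralGaloisActionProofs
import Literature.NumberTheory.GaloisRepresentations.PadicAlgebraOfLocalField
import Literature.NumberTheory.PAdicHodge.PadicBaseField
import Literature.Algebra.Polynomial.CasasAlvero.Transfer
import HarnessLib

/-!
# [AbsTopIII] Def 5.1 (i)/(iii), Def 5.6 (i)–(ii)(b) at the GENUINE pro-set `V⊚(F̄/F)`: the decomposition group of a
# nonarchimedean local element is `Gal(F̄_v/F_v)` — of MLF-Galois type, infinite, not open, not all of `G_F`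

S. Mochizuki, *Topics in absolute anabelian geometry III: global reconstruction algorithms*, J. Math. Sci. Univ.
Tokyo 22 (2015) 939–1156 [MochizukiAbsTopIII2015]; manuscript locators as in `PanalocalTheaters.lean` (abc-iut-L4-t3):
Def 5.1 (i) p. 113, (iii) p. 115, Def 5.6 (i) p. 134 ("`Ob(TG⊢)`: profinite groups isomorphic to the absolute Galois group
of an MLF"), (ii) p. 135 ("`G_w` … isomorphic to the quotient `Π_v ↠ G_v` determined by the absolute Galois group of the
base field").

PROOF-ONLY companion (no `def` / `structure` / `instance`).  For a number field `F` and the cell's GENUINE valuation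
pro-set `NumberField.valuationProSet F` (abc-iut-L4-d2, `NumberFieldValuationProSet.lean`: nonarchimedean local elements =
valuation subrings `A ≠ ⊤` of `F̄`, decomposition group = stabiliser = abc-iut-L4-t4's `decompositionGroupNF F A`), this
file ASSEMBLES BY NAME the tree's algebraic number theory of decomposition groups
(`Literature.NumberTheory.GaloisRepresentations`: `decompositionSubgroup_adicCompletionPrime_eq_range` = Neukirch, *Algebraic
Number Theory* II (9.6) `D_𝔓 = res Γ_{F_v}`; `absGaloisRestrict_adicCompletion_injective`; transitivity
`exists_smul_eq_of_mem_primesAbove_holds`; the local field structure of `F_v` with its canonical `ℚ_ℓ`-algebra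
`LocalField.padicRingHom` and `PadicBase.instFiniteDimensional`; the dictionary `exists_ideal_mem_primesAbove_of_ne_top` /
`decompositionGroupNF_eq_decompositionSubgroup` and `relIndex_decompositionGroupNF_eq_zero_of_ne` of the cell's
`NFDecomposition*Proofs`) into the statements the [AbsTopIII] §5 interface consumes:

* §1 `isMLF_adicCompletion` — the completion `F_v` of a number field at a finite place is an MLF (`IsMLF`, [AbsTopI] §0).
* §2 `exists_continuousMulEquiv_decompositionGroupNF` — for every nontrivial valuation subring `A` of `F̄` there is a finite
  place `v` of `F` with `G_A := decompositionGroupNF F A ≃ₜ* Gal(F̄_v/F_v)` (as TOPOLOGICAL groups); hence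
  **`isMLFGaloisType_decompositionGroupNF`**: `G_A ∈ Ob(TG⊢)` — Def 5.6 (ii)(b)'s "`G_v` of MLF-Galois type", the hypothesis of
  `monoAnalyticizationExists_of_isMLFGaloisType` (F-0181 instance form, p429533), AT THE GENUINE pro-set.
* §3 `infinite_decompositionGroupNF` ((S_non) of `panalocalizationExists_of_decompositionStructure`, p437068),
  `not_isOpen_decompositionGroupNF` ((S⊚′) of `panalocalizationMapsHom_of_decompositionStructure`, p438174: two distinct
  nonarchimedean primes have non-commensurable decomposition groups, and valuation subrings over `2` and over `3` are distinct),
  `decompositionGroupNF_ne_top`.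
* §4 at the pro-set: `NumberFieldValuationProSet.decomp_inr_inl_eq_decompositionGroupNF`, `isMLFGaloisType_decomp_inr_inl`,
  `infinite_decomp_of_mem_non`, `not_isOpen_decomp_inr_inl`, and the two headline laws **`eq_generic_of_decomp_eq_top`** ("`⊚` is the ONLY element of
  `V⊚(F̄/F)` fixed by all of `G_F`" — print's "unique global element `⊚`", Def 5.1 (i)) and **`eq_generic_of_isOpen_decomp`**
  (only `⊚` has an open decomposition group).  With `PanalocalTheatersStructural.lean` §4 this makes ALL the structural
  hypotheses (S⊚), (S⊚′), (S_arc), (S_non) THEOREMS at `V⊚(F̄/F)`.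

HONEST LABEL: classical algebraic number theory assembled from landed tree theorems (no new mathematics); the
`GlobalAnabelianContext` TERM at the number-field shadow is abc-iut-L4-d2's (conditional on the Neukirch–Uchida fact,
GAP G-L4d2g4-1), so nothing here DISCHARGES F-0181/F-0182 at the intended model by itself; nothing here bears on, and no side
is taken on, [IUTchIII] Cor. 3.12; typed ≠ proved.
-/

set_option autoImplicit false

noncomputable section

open scoped NumberField Pointwise
open Field IsDedekindDomain Literature.NumberTheory.GaloisRepresentations

namespace Literature.AnabelianGeometry.AbsoluteAnabelian

variable (F : Type) [Field F] [NumberField F]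

/-! ### §1: the completion at a finite place is an MLF -/

/-- **`F_v` is an MLF**: the completion of a number field `F` at a finite place `v` is a finite extension of `ℚ_ℓ` for the
rational prime `ℓ` under `v`, through the canonical embedding `ℚ_ℓ → F_v` (`LocalField.padicRingHom`; finiteness
`PadicBase.instFiniteDimensional`: a locally compact `ℚ_ℓ`-vector space is finite-dimensional).
[cite: MochizukiAbsTopIII2015, Def 5.6 (i) p. 134] -/
theorem isMLF_adicCompletion (v : HeightOneSpectrum (𝓞 F)) : IsMLF (v.adicCompletion F) := by
  obtain ⟨ℓ, hℓ, hv⟩ := exists_prime_natCast_mem_asIdeal v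
  haveI : Fact ℓ.Prime := ⟨hℓ⟩
  haveI : CharZero (v.adicCompletion F) := LocalField.charZero_adicCompletion v
  have hlt : ValuativeRel.valuation (v.adicCompletion F) (ℓ : v.adicCompletion F) < 1 :=
    LocalField.valuation_adicCompletion_natCast_lt_one v ℓ hv
  exact ⟨ℓ, ⟨hℓ⟩, LocalField.padicRingHom (v.adicCompletion F) ℓ hlt,
    Literature.NumberTheory.PAdicHodge.PadicBase.instFiniteDimensional (F := v.adicCompletion F) (p := ℓ) hlt⟩

/-! ### §2: `G_A ≅ Gal(F̄_v/F_v)` as topological groups; MLF-Galois type -/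

set_option synthInstance.maxHeartbeats 160000 in
/-- **`G_A ≅ Gal(F̄_v/F_v)`.**  For a nontrivial valuation subring `A` of `F̄` (a nonarchimedean prime of `F̄`) there is a
finite place `v` of `F` (the one under `A`) and an isomorphism of TOPOLOGICAL groups between the decomposition group
`G_A ⊆ G_F` and the absolute Galois group of the completion `F_v`: `G_A = D_𝔓` for the prime `𝔓 = 𝔪_A ∩ \bar ℤ_F` above `v`,
`𝔓 = σ • 𝔓₀` for the prime `𝔓₀` cut out by `F̄ → \bar F_v` (transitivity), `D_{𝔓₀} = res(Γ_{F_v})` (Neukirch II (9.6)) with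
`res` injective and continuous, so `σ · res(−) · σ⁻¹ : Γ_{F_v} → G_A` is a continuous group isomorphism from a compact group
onto a Hausdorff one. [cite: MochizukiAbsTopIII2015, Def 5.6 (ii) p. 135] -/
theorem exists_continuousMulEquiv_decompositionGroupNF (A : ValuationSubring (AlgebraicClosure F)) (hA : A ≠ ⊤) :
    ∃ v : HeightOneSpectrum (𝓞 F),
      Nonempty (absoluteGaloisGroup (v.adicCompletion F) ≃ₜ* decompositionGroupNF F A) := by
  obtain ⟨v, 𝔓, h𝔓v, h𝔓⟩ := exists_ideal_mem_primesAbove_of_ne_top A hA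
  refine ⟨v, ?_⟩
  haveI : CharZero (v.adicCompletion F) := LocalField.charZero_adicCompletion v
  -- `𝔓 = σ • 𝔓₀`
  obtain ⟨σ, hσ⟩ := HeightOneSpectrum.exists_smul_eq_of_mem_primesAbove_holds (K := F) (v := v)
    (adicCompletionPrime_mem_primesAbove F v) h𝔓v
  -- the continuous injective homomorphism `φ = σ · res(−) · σ⁻¹ : Γ_{F_v} → G_F`
  let res : absoluteGaloisGroup (v.adicCompletion F) →ₜ* absoluteGaloisGroup F :=
    absGaloisRestrict F (v.adicCompletion F)
  let φ : absoluteGaloisGroup (v.adicCompletion F) →* absoluteGaloisGroup F :=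
    (MulAut.conj σ).toMonoidHom.comp res.toMonoidHom
  have hφ_inj : Function.Injective φ := fun a b hab =>
    absGaloisRestrict_adicCompletion_injective F v ((MulAut.conj σ).injective hab)
  have hφ_cont : Continuous φ := by
    change Continuous fun x => σ * res x * σ⁻¹
    exact (res.continuous.const_mul σ).mul_const σ⁻¹
  -- its range is `G_A = D_𝔓 = D_{σ • 𝔓₀} = σ D_{𝔓₀} σ⁻¹ = σ res(Γ_{F_v}) σ⁻¹`
  have hrange : φ.range = decompositionGroupNF F A := by
    rw [decompositionGroupNF_eq_decompositionSubgroup A 𝔓 h𝔓, ← hσ, Ideal.decompositionSubgroup_smul,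
      decompositionSubgroup_adicCompletionPrime_eq_range F v]
    ext τ
    rw [MonoidHom.mem_range, Subgroup.mem_smul_pointwise_iff_exists]
    constructor
    · rintro ⟨x, rfl⟩
      exact ⟨res x, ⟨x, rfl⟩, rfl⟩
    · rintro ⟨y, ⟨x, rfl⟩, rfl⟩
      exact ⟨x, rfl⟩
  -- the group isomorphism onto the range, continuous from compact to Hausdorff
  let e : absoluteGaloisGroup (v.adicCompletion F) ≃* decompositionGroupNF F A :=
    (MonoidHom.ofInjective hφ_inj).trans (MulEquiv.subgroupCongr hrange)
  have he : ∀ x, ((e x : decompositionGroupNF F A) : absoluteGaloisGroup F) = φ x := fun x => rfl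
  have he_cont : Continuous e := by
    refine continuous_induced_rng.2 ?_
    have : (Subtype.val ∘ e) = φ := funext he
    rw [this]
    exact hφ_cont
  have he_symm_cont : Continuous e.symm :=
    Continuous.continuous_symm_of_equiv_compact_to_t2 (f := e.toEquiv) he_cont
  exact ⟨{ e with continuous_toFun := he_cont, continuous_invFun := he_symm_cont }⟩

/-- **The decomposition group of a nonarchimedean prime of `F̄` is of MLF-Galois type** (an object of `TG⊢`, Def 5.6 (i)):
`G_A ≅ Gal(F̄_v/F_v)` with `F_v` an MLF — Def 5.6 (ii)(b)'s "`G_w` … the quotient `Π_v ↠ G_v` determined by the absolute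
Galois group of the base field", i.e. the hypothesis of `monoAnalyticizationExists_of_isMLFGaloisType` (F-0181 instance form),
PROVED at the genuine pro-set. [cite: MochizukiAbsTopIII2015, Def 5.6 (ii) p. 135] -/
theorem isMLFGaloisType_decompositionGroupNF (A : ValuationSubring (AlgebraicClosure F)) (hA : A ≠ ⊤) :
    IsMLFGaloisType (ProfiniteGrp.ofClosedSubgroup (G := absoluteGaloisGrp F)
      ⟨decompositionGroupNF F A, isClosed_decompositionGroupNF F A⟩) := by
  obtain ⟨v, ⟨e⟩⟩ := exists_continuousMulEquiv_decompositionGroupNF F A hA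
  haveI : CharZero (v.adicCompletion F) := LocalField.charZero_adicCompletion v
  exact ⟨v.adicCompletion F, inferInstance, inferInstance, isMLF_adicCompletion F v, ⟨e.symm⟩⟩

/-! ### §3: `G_A` is infinite, not open, not all of `G_F` -/

/-- **(S_non) `G_A` is infinite**: it is isomorphic to the absolute Galois group of an MLF (`IsMLF.infinite_absoluteGaloisGroup`).
[cite: MochizukiAbsTopIII2015, Def 5.1 (iii) p. 115] -/
theorem infinite_decompositionGroupNF (A : ValuationSubring (AlgebraicClosure F)) (hA : A ≠ ⊤) :
    (decompositionGroupNF F A : Set (absoluteGaloisGroup F)).Infinite := by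
  obtain ⟨v, ⟨e⟩⟩ := exists_continuousMulEquiv_decompositionGroupNF F A hA
  haveI := (isMLF_adicCompletion F v).infinite_absoluteGaloisGroup
  haveI : Infinite (decompositionGroupNF F A) := Infinite.of_injective e e.injective
  exact Set.infinite_coe_iff.mp ‹_›

/-- A valuation subring of `F̄` in which the rational prime `p` is a non-unit is nontrivial.
[cite: MochizukiAbsTopIII2015, Def 5.1 (i) p. 113] -/
theorem valuationSubring_ne_top_of_valuation_natCast_lt_one {A : ValuationSubring (AlgebraicClosure F)} {p : ℕ}
    (hp : p ≠ 0) (h : A.valuation (p : AlgebraicClosure F) < 1) : A ≠ ⊤ := by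
  rintro rfl
  have hmem : ((p : AlgebraicClosure F)⁻¹) ∈ (⊤ : ValuationSubring (AlgebraicClosure F)) :=
    ValuationSubring.mem_top _
  have hle := ((⊤ : ValuationSubring (AlgebraicClosure F)).valuation_le_one_iff _).mpr hmem
  have hp0 : (p : AlgebraicClosure F) ≠ 0 := by exact_mod_cast hp
  have hpos : 0 < (⊤ : ValuationSubring (AlgebraicClosure F)).valuation (p : AlgebraicClosure F) :=
    zero_lt_iff.mpr (((⊤ : ValuationSubring (AlgebraicClosure F)).valuation.ne_zero_iff).mpr hp0)
  rw [map_inv₀, inv_le_one₀ hpos] at hle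
  exact absurd h (not_lt.mpr hle)

/-- **Two distinct nonarchimedean primes of `F̄`**: valuation subrings of `F̄` over the rational primes `2` and `3`
(Chevalley, `exists_valuationSubring_valuation_lt_one`) exist and are distinct (`3 − 2 = 1` is a unit).
[cite: MochizukiAbsTopIII2015, Def 5.1 (i) p. 113] -/
theorem exists_valuationSubring_ne_top_ne :
    ∃ A B : ValuationSubring (AlgebraicClosure F), A ≠ ⊤ ∧ B ≠ ⊤ ∧ A ≠ B := by
  haveI : Fact (Nat.Prime 2) := ⟨Nat.prime_two⟩
  haveI : Fact (Nat.Prime 3) := ⟨Nat.prime_three⟩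
  obtain ⟨A, hA⟩ :=
    Literature.Algebra.Polynomial.CasasAlvero.exists_valuationSubring_valuation_lt_one (AlgebraicClosure F) 2
  obtain ⟨B, hB⟩ :=
    Literature.Algebra.Polynomial.CasasAlvero.exists_valuationSubring_valuation_lt_one (AlgebraicClosure F) 3
  refine ⟨A, B, valuationSubring_ne_top_of_valuation_natCast_lt_one F two_ne_zero hA,
    valuationSubring_ne_top_of_valuation_natCast_lt_one F three_ne_zero hB, ?_⟩
  rintro rfl
  have h1 : A.valuation (((3 : ℕ) : AlgebraicClosure F) - ((2 : ℕ) : AlgebraicClosure F)) < 1 :=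
    lt_of_le_of_lt (A.valuation.map_sub _ _) (max_lt hB hA)
  have h2 : (((3 : ℕ) : AlgebraicClosure F) - ((2 : ℕ) : AlgebraicClosure F)) = 1 := by norm_num
  rw [h2, map_one] at h1
  exact lt_irrefl _ h1

/-- **(S⊚′, nonarchimedean half) `G_A` is NOT OPEN in `G_F`**: an open subgroup has finite index, but for a second
nonarchimedean prime `B ≠ A` the decomposition groups `G_A`, `G_B` are non-commensurable — `G_A ∩ G_B` has infinite index in
`G_B` (`relIndex_decompositionGroupNF_eq_zero_of_ne`, [NSW] 12.1.3), which forces `[G_F : G_A] = ∞`.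
[cite: MochizukiAbsTopIII2015, Def 5.1 (iii) p. 115] -/
theorem not_isOpen_decompositionGroupNF (A : ValuationSubring (AlgebraicClosure F)) (hA : A ≠ ⊤) :
    ¬ IsOpen (decompositionGroupNF F A : Set (absoluteGaloisGroup F)) := by
  intro hopen
  obtain ⟨A₁, A₂, h₁, h₂, hne⟩ := exists_valuationSubring_ne_top_ne F
  -- some nonarchimedean prime `B ≠ A`
  obtain ⟨B, hB, hBA⟩ : ∃ B : ValuationSubring (AlgebraicClosure F), B ≠ ⊤ ∧ B ≠ A := by
    by_cases h : A₁ = A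
    · exact ⟨A₂, h₂, fun h' => hne (h.trans h'.symm)⟩
    · exact ⟨A₁, h₁, h⟩
  have h0 : (decompositionGroupNF F A).relIndex (decompositionGroupNF F B) = 0 :=
    relIndex_decompositionGroupNF_eq_zero_of_ne B A hB hA hBA
  have hidx : (decompositionGroupNF F A).index = 0 := Subgroup.index_eq_zero_of_relIndex_eq_zero h0
  haveI : Finite (absoluteGaloisGroup F ⧸ decompositionGroupNF F A) :=
    Subgroup.quotient_finite_of_isOpen _ hopen
  exact Subgroup.index_ne_zero_of_finite hidx

/-- **(S⊚, nonarchimedean half) `G_A ≠ G_F`**: no nonarchimedean prime of `F̄` is fixed by all of `Gal(F̄/F)`.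
[cite: MochizukiAbsTopIII2015, Def 5.1 (i) p. 113] -/
theorem decompositionGroupNF_ne_top (A : ValuationSubring (AlgebraicClosure F)) (hA : A ≠ ⊤) :
    decompositionGroupNF F A ≠ ⊤ := by
  intro h
  refine not_isOpen_decompositionGroupNF F A hA ?_
  rw [h, Subgroup.coe_top]
  exact isOpen_univ

/-! ### §4: at the pro-set `V⊚(F̄/F)` -/

namespace NumberFieldValuationProSet

omit [NumberField F] in
/-- The pro-set's decomposition group of a nonarchimedean local element `A` IS `decompositionGroupNF F A` (both are the
pull-back of Mathlib's `ValuationSubring.decompositionSubgroup`). [cite: MochizukiAbsTopIII2015, Def 5.1 (iii) p. 115] -/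
theorem decomp_inr_inl_eq_decompositionGroupNF (A : NonArch F) :
    (NumberField.valuationProSet F).decomp (Sum.inr (Sum.inl A)) = decompositionGroupNF F A.1 := by
  rw [decomp_inr_inl]
  rfl

/-- At `V⊚(F̄/F)`: **the decomposition group of a nonarchimedean local element is of MLF-Galois type** (Def 5.6 (ii)(b)).
[cite: MochizukiAbsTopIII2015, Def 5.6 (ii) p. 135] -/
theorem isMLFGaloisType_decomp_inr_inl (A : NonArch F) :
    IsMLFGaloisType (ProfiniteGrp.ofClosedSubgroup (G := absoluteGaloisGrp F)
      ⟨(NumberField.valuationProSet F).decomp (Sum.inr (Sum.inl A)),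
        (NumberField.valuationProSet F).isClosed_decomp _⟩) := by
  have h := isMLFGaloisType_decompositionGroupNF F A.1 A.2
  have heq : (⟨(NumberField.valuationProSet F).decomp (Sum.inr (Sum.inl A)),
      (NumberField.valuationProSet F).isClosed_decomp _⟩ : ClosedSubgroup (absoluteGaloisGrp F)) =
      ⟨decompositionGroupNF F A.1, isClosed_decompositionGroupNF F A.1⟩ := by
    ext σ
    change σ ∈ (NumberField.valuationProSet F).decomp (Sum.inr (Sum.inl A)) ↔ σ ∈ decompositionGroupNF F A.1
    rw [decomp_inr_inl_eq_decompositionGroupNF]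
  rw [heq]
  exact h

/-- At `V⊚(F̄/F)`: (S_non) — the decomposition group of a nonarchimedean local element is infinite.
[cite: MochizukiAbsTopIII2015, Def 5.1 (iii) p. 115] -/
theorem infinite_decomp_of_mem_non (v : (NumberField.valuationProSet F).carrier)
    (hv : v ∈ (NumberField.valuationProSet F).non) :
    ((NumberField.valuationProSet F).decomp v : Set (absoluteGaloisGroup F)).Infinite := by
  obtain ⟨A, rfl⟩ := hv
  rw [decomp_inr_inl_eq_decompositionGroupNF]
  exact infinite_decompositionGroupNF F A.1 A.2

/-- At `V⊚(F̄/F)`: the decomposition group of a nonarchimedean local element is not open.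
[cite: MochizukiAbsTopIII2015, Def 5.1 (iii) p. 115] -/
theorem not_isOpen_decomp_inr_inl (A : NonArch F) :
    ¬ IsOpen (((NumberField.valuationProSet F).decomp (Sum.inr (Sum.inl A))) : Set (absoluteGaloisGroup F)) := by
  rw [decomp_inr_inl_eq_decompositionGroupNF]
  exact not_isOpen_decompositionGroupNF F A.1 A.2

/-- **(S⊚′) at `V⊚(F̄/F)`: only `⊚` has an open decomposition group** — a local element whose decomposition group is open in
`G_F` is the generic element. [cite: MochizukiAbsTopIII2015, Def 5.1 (i) p. 113] -/
theorem eq_generic_of_isOpen_decomp (v : (NumberField.valuationProSet F).carrier)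
    (h : IsOpen ((NumberField.valuationProSet F).decomp v : Set (absoluteGaloisGroup F))) :
    v = (NumberField.valuationProSet F).generic := by
  rcases (NumberField.valuationProSet F).eq_generic_or_mem v with hv | ⟨A, rfl⟩ | ⟨w, rfl⟩
  · exact hv
  · exact absurd h (not_isOpen_decomp_inr_inl F A)
  · exact absurd h (not_isOpen_decomp_inr_inr F w)

/-- **(S⊚) at `V⊚(F̄/F)`: `⊚` is the UNIQUE element fixed by all of `G_F`** ("the inverse system of `⊚_K`'s determines a unique
global element", Def 5.1 (i); hypothesis (S⊚) of `panalocalizationExists_of_decompositionStructure`).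
[cite: MochizukiAbsTopIII2015, Def 5.1 (i) p. 113] -/
theorem eq_generic_of_decomp_eq_top (v : (NumberField.valuationProSet F).carrier)
    (h : (NumberField.valuationProSet F).decomp v = ⊤) : v = (NumberField.valuationProSet F).generic :=
  eq_generic_of_isOpen_decomp F v (by rw [h, Subgroup.coe_top]; exact isOpen_univ)

end NumberFieldValuationProSet

end Literature.AnabelianGeometry.AbsoluteAnabelian

end
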